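import Literature.Barriers.NavierStokesRegularity.ForcedLerayHopfNonuniqueness
import Literature.Analysis.FluidPDE.NSLerayHopfABCScaling
import HarnessLib

/-!
# Barrier `ForcedLerayHopfNonuniqueness`: reduction to the unit-viscosity theorem (DEPRECATED)

Sibling proof file (theorem-only, no definitions, no named facts) of the barrier catalogue entry
`Literature/Barriers/NavierStokesRegularity/ForcedLerayHopfNonuniqueness` (D-0021), written for
its ORIGINAL declaration `ForcedLerayHopfNonuniqueness`, which the verdict clean-up of 2026-08-16
deprecated (section "Status" below; the catalogued barrier is now
`ForcedLerayHopfNonuniquenessNarrow`). The (deprecated) barrier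
fact `ForcedLerayHopfNonuniqueness` is *definitionally* the tree's ns.S20
`Literature.Analysis.FluidPDE.albritton_brue_colombo` (non-uniqueness of Leray–Hopf solutions of
the forced system for **every** viscosity `ν > 0`), whereas Albritton–Brué–Colombo print the
theorem for the system `∂ₜu + u·∇u − Δu + ∇p = f`, i.e. at `ν = 1` (arXiv:2112.03116, Def. 1.1 and
Thm. 1.2; the barrier file's module docstring records the numbering). The tree carries the
unit-viscosity statement as the named fact `Literature.Analysis.FluidPDE.albritton_brue_colombo_unit`
together with the **proved** viscosity scaling of the accepted notions
(`IsLerayHopfOn.viscosityRescale`, `MemLqLp.viscosityRescale`, `albritton_brue_colombo_of_unit`,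
`albritton_brue_colombo_of_viscosity`; `Literature/Analysis/FluidPDE/NSLerayHopfABCScaling.lean`).
This file threads that reduction to the barrier declaration — **implications only**:

* `ForcedLerayHopfNonuniqueness.of_unit` — the unit-viscosity named fact implies the barrier fact;
* `ForcedLerayHopfNonuniqueness.of_viscosity` — the barrier fact's own rendering at any ONE
  viscosity `ν₀ > 0` (written out in full) implies it at every viscosity.

No equivalence "barrier fact ↔ printed theorem" is recorded (the former
`forcedLerayHopfNonuniqueness_iff_unit` is withdrawn). Reason: the barrier fact is definitionally
the tree's rendering of ns.S20, whose force is quantified only through the slice-wise mixed class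
`MemLqLp 1 2 f (Ioo 0 T)` (no measurability of `t ↦ f t`), and that rendering is provable by a
degenerate non-measurable force — `Literature.Analysis.FluidPDE.ABCVacuity.rendering_is_vacuous`
(`Literature/Analysis/FluidPDE/NSLerayHopfABCVacuity.lean`, accepted with the explicit caveat that
it is a witness of a statement defect, not a formalisation of the paper). It is therefore
*weaker* than Albritton–Brué–Colombo's Thm. 1.2, whose force lies in the Bochner class
`f ∈ L¹_t L²_x(ℝ³ × (0,T))` of Def. 1.1 (jointly measurable; in the tree's vocabulary the extra
clause `AEStronglyMeasurable (uncurry f) (volume.restrict (Ioo 0 T ×ˢ univ))`, carried on the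
Analysis side by the unit-viscosity fact), and an `↔` would misstate the debt of the catalogue
entry. The printed `ν = 1` instance of the barrier fact's own rendering remains the proved
corollary `ForcedLerayHopfNonuniqueness.at_viscosity_one` of the barrier file.

What is NOT here: a proof of Thm. 1.2 itself (Thm. 1.3 ⟸ §2 Vishik's unstable vortex, truncated
and lifted to an axisymmetric vortex ring, §3 Thm. 3.1 / Cor. 3.2 spectral perturbation from Euler
to the self-similar Navier–Stokes operator, §4 Thm. 4.1 nonlinear instability on the unstable
manifold), nor any repair of the barrier declaration (a `Literature/Barriers/` statement; not
edited from a proofs file).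

## Status (verdict clean-up 2026-08-16): both theorems deprecated with the barrier fact

The barrier file's verdict clean-up of 2026-08-16 deprecated `ForcedLerayHopfNonuniqueness` as
mis-stated — vacuous as a Lean proposition for exactly the reason recorded above
(`ABCVacuity.rendering_is_vacuous`) — in favour of the audited, faithful
`ForcedLerayHopfNonuniquenessNarrow` (jointly measurable force, the Bochner class of Def. 1.1;
now the catalogued barrier), see the sections "Verdict clean-up" and "Deprecated" of
`ForcedLerayHopfNonuniqueness.lean`. Both theorems of this file conclude the deprecated rendering
and are therefore deprecated with it, statements byte-for-byte (Lean reports no deprecation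
warning inside a deprecated declaration, so no `linter.deprecated` override is needed). Their
content survives undeprecated, with the conclusion unfolded to ns.S20 `albritton_brue_colombo`, as
the Analysis-side scaling theorems they wrap — `Literature.Analysis.FluidPDE.albritton_brue_colombo_of_unit`
and `Literature.Analysis.FluidPDE.albritton_brue_colombo_of_viscosity` (`NSLerayHopfABCScaling.lean`) —
and the faithful every-viscosity statement WITH the measurability clause is
`ForcedLerayHopfNonuniquenessNarrow.forall_viscosity` /
`Literature.Analysis.FluidPDE.albritton_brue_colombo_unit_iff_forall_viscosity`.

## References

* D. Albritton, E. Brué, M. Colombo, *Non-uniqueness of Leray solutions of the forced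
  Navier–Stokes equations*, Ann. of Math. 196 (2022) 415–455 = arXiv:2112.03116, Def. 1.1,
  Thm. 1.2, Thm. 1.3, §1.1 (1.5)–(1.6) with footnote 1 (held: `paper:arxiv-2112.03116`, pp. 3, 5).
  [`AlbrittonBrueColombo2022AnnMath`]
* T. Tao, *Localisation and compactness properties of the Navier–Stokes global regularity
  problem*, Anal. PDE 6 (2013) = arXiv:1108.1165, footnote 3 (viscosity rescaling). [`Tao2011`]
-/

noncomputable section

open MeasureTheory Set

namespace Literature.Barriers.NavierStokesRegularity

/-- **Deprecated with the barrier fact it concludes (verdict clean-up 2026-08-16)** — use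
`Literature.Analysis.FluidPDE.albritton_brue_colombo_of_unit` (same content, conclusion unfolded to
ns.S20 `albritton_brue_colombo`), or `ForcedLerayHopfNonuniquenessNarrow.forall_viscosity` for the
faithful every-viscosity statement with a measurable force. *Original content* — **the barrier
fact from the unit-viscosity theorem.** The tree's unit-viscosity named fact
`Literature.Analysis.FluidPDE.albritton_brue_colombo_unit` (Albritton–Brué–Colombo's Thm. 1.2 is
printed at `ν = 1`) implies `ForcedLerayHopfNonuniqueness` (every `ν > 0`): the barrier fact is
definitionally ns.S20 `albritton_brue_colombo`, which follows from the unit-viscosity statement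
by the proved viscosity scaling `Literature.Analysis.FluidPDE.albritton_brue_colombo_of_unit`
(rescale the pair by `u ↦ ν u(ν ·, ·)`, `f ↦ ν² f(ν ·, ·)` on `(0, T/ν)`; the viscosity
normalisation is the one of Tao 2013, footnote 3, as in the tree's
`IsClassicalNSSolutionOn.viscosityRescale`, while the paper's own (1.5)–(1.6) is the parabolic
scaling at fixed viscosity, footnote 1 treating `ν` as dimensionless). Only this direction is
recorded (see the module docstring). [cite: AlbrittonBrueColombo2022AnnMath, Thm. 1.2 with Def. 1.1 (printed at ν = 1)] -/
@[deprecated Literature.Analysis.FluidPDE.albritton_brue_colombo_of_unit (since := "2026-08-16")]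
theorem ForcedLerayHopfNonuniqueness.of_unit
    (h : Literature.Analysis.FluidPDE.albritton_brue_colombo_unit) : ForcedLerayHopfNonuniqueness :=
  Literature.Analysis.FluidPDE.albritton_brue_colombo_of_unit h

/-- **Deprecated with the barrier fact it concludes (verdict clean-up 2026-08-16)** — use
`Literature.Analysis.FluidPDE.albritton_brue_colombo_of_viscosity` (same content, conclusion
unfolded to ns.S20 `albritton_brue_colombo`); note that its hypothesis is the measurability-free
single-viscosity rendering, from which the faithful statement `ForcedLerayHopfNonuniquenessNarrow`
does NOT follow (this is why the barrier fact could not be corrected in place). *Original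
content* — **the barrier fact from its rendering at any single viscosity.** If, for some `ν₀ > 0`,
there are `T > 0`, a force in the (slice-wise) class `L¹(0,T; L²(ℝ³))` and two Leray–Hopf
solutions with viscosity `ν₀` from `u₀ = 0` differing at a time in `(0, T)` — the body of the
barrier fact at `ν₀`, written out — then `ForcedLerayHopfNonuniqueness` holds (every `ν > 0`), by
the proved viscosity scaling `Literature.Analysis.FluidPDE.albritton_brue_colombo_of_viscosity`
(`c = ν/ν₀`). With `ν₀ = 1` this inverts the corollary
`ForcedLerayHopfNonuniqueness.at_viscosity_one` of the barrier file. [cite: Tao2011, footnote 3] -/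
@[deprecated Literature.Analysis.FluidPDE.albritton_brue_colombo_of_viscosity (since := "2026-08-16")]
theorem ForcedLerayHopfNonuniqueness.of_viscosity {ν₀ : ℝ} (hν₀ : 0 < ν₀)
    (h : ∃ T : ℝ, 0 < T ∧ ∃ f : ℝ → EuclideanSpace ℝ (Fin 3) → EuclideanSpace ℝ (Fin 3),
      Literature.Analysis.FluidPDE.MemLqLp 1 2 f (Ioo 0 T) ∧
      ∃ u v : ℝ → EuclideanSpace ℝ (Fin 3) → EuclideanSpace ℝ (Fin 3),
        Literature.Analysis.FluidPDE.IsLerayHopfOn T ν₀ f 0 u ∧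
        Literature.Analysis.FluidPDE.IsLerayHopfOn T ν₀ f 0 v ∧
        ∃ t ∈ Ioo 0 T, ¬ (u t =ᵐ[volume] v t)) :
    ForcedLerayHopfNonuniqueness :=
  Literature.Analysis.FluidPDE.albritton_brue_colombo_of_viscosity hν₀ h

end Literature.Barriers.NavierStokesRegularity
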